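import Summits.HodgeConjecture.HodgeConjecture.Theorems.F0P3TowerGlue
import Summits.HodgeConjecture.HodgeConjecture.Theorems.H413CuspCotPin
import Summits.HodgeConjecture.HodgeConjecture.Theorems.H413HolCotFormsOfModel
import Summits.HodgeConjecture.HodgeConjecture.Theorems.P4StubT1ArchFactor
import HarnessLib

/-!
# FLOOR-0 P3, stub S1 — JUNCTION of the inverse gluing with A-p13's class map: `glue` and `towerFamily` ∕ `clsHol` are mutually inverse;
# the `(1,0)`-part of the tower is EXACTLY the range of the holomorphic class map

Cell hodgecm-mathlib (D-0151), FLOOR 0, crux item H413 = stmt-HodgeConjecture-24833; programme P3 «U3-mult», line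
`Cruxes/H413/Lines/F0_U3CohMultOne.lean` v1.1, stub S1 (with P4-T2 the «ONE theorem»: the class map is an equivariant ISOMORPHISM).
Author F0P3-p01 (g0).  `--supports stmt-HodgeConjecture-24833 --as helper`.  Theorems only.

* `comp_toRegimeFun_glue` — the components of the glued form (read on the regime model through A-p13's `toRegimeFun`) are the harmonic
  pull-backs `levelPull c_h`; hence for a `(1,0)`-family `c ∈ H_K`: `toRegimeFun (glue c) ∈ cuspCotSat V hV Γ.K`, `compClass (…) h = c_h`,
  **`towerFamily (toRegimeFun (glue c)) = c`**, `clsAt (…) = ofLevel c`, **`clsHol ⟨glue c, _⟩ = ofLevel c`** (`glue` is a RIGHT INVERSE of the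
  class map on `(1,0)`-families);
* `glue_towerFamily` — conversely `glue (towerFamily F) = F ∘ e` for a saturated cuspidal cotangent form `F` of level `Γ.K` (LEFT INVERSE; the
  honesty of the factor of record, ★ `archFactorOf_isHonest`, clause (6));
* **`range_clsHol_eq_H10T`** — the range of A-p13's injective equivariant `clsHol : holCotForms 𝔞₀ →ₗ H` IS the `(1,0)`-part `H10T` of the tower
  (A-p19's `Theorems/H413TowerConj`): with ★ `clsHol_injective` this is the HOLOMORPHIC MATSUSHIMA ISOMORPHISM `holCotForms 𝔞₀ ≅ H^{1,0}(tower)`;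
  the full `cohForms 𝔞₀ ≅ H = H^{1,0} ⊕ H^{0,1}` follows with T2b∕T2c (`conjT`, ★ `isCompl_holCotForms_map_conjFun`) and A-p19's
  `isCompl_H10T_map_conjT` — recorded by the seats holding those files.

HC_CM is proved only modulo the printed citations until rung 0 closes; this file proves nothing about them.
[cite: BorelWallach2000, VII 3.2, XIII 1.2] [cite: VoisinHodgeI2002, §7.1.1 Cor. 7.6] [cite: BorelJacquet1979, §4.1–§4.2]

## References
* [BorelWallach2000] A. Borel, N. Wallach, Math. Surveys Monogr. 67 (2000), VII 3.2 (Matsushima's formula), XIII 1.2 (adelic pieces).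
* [VoisinHodgeI2002] C. Voisin, *Hodge Theory and Complex Algebraic Geometry I*, CUP 2002, §7.1.1 Cor. 7.6.
* [BorelJacquet1979] A. Borel, H. Jacquet, Corvallis PSPM 33.1, §4.1–§4.2.
* Tree: ★ `Theorems/F0P3TowerGlue` (this seat), ★ `Theorems/H413CuspCot{Components,Tower,Transport,ClassMap}` (A-p13 (g21)), ★ `Theorems/H413TowerConj`
  (A-p19 (g15)), ★ `Theorems/H413HolCotFormsOfModel` (A-p17 (g12)), ★ `Theorems/P4StubT1ArchFactor`.
-/

set_option autoImplicit false
set_option linter.dupNamespace false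

noncomputable section

open MulAction NumberField
open Literature.NumberTheory.Automorphic Literature.NumberTheory.Automorphic.UnitaryGroup
open Literature.Geometry.ComplexHyperbolic.BallModel (U21 x₀)
open Literature.AlgebraicGeometry.HodgeTheory Literature.AlgebraicGeometry.ShimuraVarieties
open Literature.NumberTheory.Automorphic.PicardCM
open Literature.NumberTheory.Transcendental (Arapura2012_Cor_15_4_6)
open HodgeCM HodgeCM.Model HodgeCM.Model.LevelTranslate HodgeCM.Model.TowerLevel HodgeCM.Model.TowerCarrier
open Summit.HodgeConjecture.HodgeConjecture.Cruxes.H413.CohFormsCarriers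
open Summit.HodgeConjecture.HodgeConjecture.Cruxes.H413.TowerConj

namespace Summit.HodgeConjecture.HodgeConjecture.Cruxes.H413.CuspCot

variable {F : HodgeCM.CMField} {ι₁ : F →+* ℂ} {V : HodgeCM.HermSpace3 F ι₁}
variable (hHD : exists_isReal_hodgeModel) (hI : hodgePQ_independent_of_hodgeModel)
  (h₁ : BallQuotientUniformised) (h₃ : CMAbelianVarietyRealised) (hA : Arapura2012_Cor_15_4_6)
variable (hV : IsAnisotropic F (HodgeCM.HermSpace3.Hm V)) {Γ : Level V} (hΓ : Γ.BelowConjThree)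

/-! ## §1 `glue` is a right inverse of A-p13's «components ↦ classes» -/

/-- **The components of the glued form are the harmonic pull-backs**: `comp (glue c ∘ e⁻¹) h = levelPull c_h`. [cite: BorelWallach2000, XIII 1.2] -/
theorem comp_toRegimeFun_glue (c : Π h : ↥(HodgeCM.HermSpace3.adelicFin V), W hHD hI (ballQuotientUniformisedDatum_of h₁) h₃ Γ hΓ h)
    (h : ↥(HodgeCM.HermSpace3.adelicFin V)) :
    comp V hV (toRegimeFun F V hV (glue hHD hI h₁ h₃ hV hΓ c)) h =
      (levelPull hHD hI h₁ h₃ hV (Γ.conj h hΓ) (c h) : ↥U21 → (Fin 2 → ℂ)) := by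
  rw [comp_toRegimeFun]
  funext u
  exact glue_ιinf_mul_finToAdelic hHD hI h₁ h₃ hV hΓ c u h

variable {hΓ}

/-- For a `(1,0)`-family `c ∈ H_K`, the glued form read on the regime model is a saturated cuspidal cotangent form of level `Γ.K`
(A-p13's forward transport ★ `toRegimeFun_mem_cuspCotSat`). [cite: BorelJacquet1979, §4.1–§4.2] -/
theorem toRegimeFun_glue_mem_cuspCotSat (c : ↥(towerLevel hHD hI (ballQuotientUniformisedDatum_of h₁) h₃ hA Γ hΓ))
    (hc : c ∈ H10L hHD hI (ballQuotientUniformisedDatum_of h₁) h₃ hA Γ hΓ) :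
    toRegimeFun F V hV (glue hHD hI h₁ h₃ hV hΓ (c : Π h, W hHD hI (ballQuotientUniformisedDatum_of h₁) h₃ Γ hΓ h)) ∈
      cuspCotSat V hV Γ.K :=
  toRegimeFun_mem_cuspCotSat (glue_mem_holCotForms hHD hI h₁ h₃ hA hV c hc) fun _ hk => rightRep_glue_of_mem hHD hI h₁ h₃ hA hV c hc hk

/-- **`compClass (glue c ∘ e⁻¹) h = c_h`.** [cite: BorelWallach2000, VII 3.2] -/
theorem compClass_glue (c : ↥(towerLevel hHD hI (ballQuotientUniformisedDatum_of h₁) h₃ hA Γ hΓ))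
    (hc : c ∈ H10L hHD hI (ballQuotientUniformisedDatum_of h₁) h₃ hA Γ hΓ) (h : ↥(HodgeCM.HermSpace3.adelicFin V)) :
    (compClass hHD hI h₁ h₃ hΓ (toRegimeFun_glue_mem_cuspCotSat hHD hI h₁ h₃ hA hV c hc) h :
        (picardCMUniverse hHD hI h₁ h₃).CohC ((picardCMUniverse hHD hI h₁ h₃).pms F ι₁ V (Γ.conj h hΓ)) 1) =
      (c : Π h, W hHD hI (ballQuotientUniformisedDatum_of h₁) h₃ Γ hΓ h) h :=
  eq_of_pull_eq hHD hI h₁ h₃ hV _ ⟨_, (mem_H10L_iff hHD hI (ballQuotientUniformisedDatum_of h₁) h₃ hA c).1 hc h⟩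
    (by rw [pull_compClass, comp_toRegimeFun_glue]; rfl)

/-- **`towerFamily (glue c ∘ e⁻¹) = c`**: `glue` is a right inverse of A-p13's «form ↦ cohomological family». [cite: BorelWallach2000, XIII 1.2] -/
theorem towerFamily_glue (c : ↥(towerLevel hHD hI (ballQuotientUniformisedDatum_of h₁) h₃ hA Γ hΓ))
    (hc : c ∈ H10L hHD hI (ballQuotientUniformisedDatum_of h₁) h₃ hA Γ hΓ) :
    (⟨towerFamily hHD hI h₁ h₃ hΓ (toRegimeFun_glue_mem_cuspCotSat hHD hI h₁ h₃ hA hV c hc),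
        towerFamily_mem hHD hI h₁ h₃ hA hΓ (toRegimeFun_glue_mem_cuspCotSat hHD hI h₁ h₃ hA hV c hc)⟩ :
        ↥(towerLevel hHD hI (ballQuotientUniformisedDatum_of h₁) h₃ hA Γ hΓ)) = c := by
  apply Subtype.ext
  funext h
  exact (towerFamily_apply hHD hI h₁ h₃ hΓ _ h).trans (compClass_glue hHD hI h₁ h₃ hA hV c hc h)

/-- **`clsAt Γ (glue c ∘ e⁻¹) = ofLevel Γ c`.** [cite: BorelWallach2000, VII 3.2; XIII 1.2] -/
theorem clsAt_glue (c : ↥(towerLevel hHD hI (ballQuotientUniformisedDatum_of h₁) h₃ hA Γ hΓ))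
    (hc : c ∈ H10L hHD hI (ballQuotientUniformisedDatum_of h₁) h₃ hA Γ hΓ) :
    clsAt hHD hI h₁ h₃ hA Γ hΓ ⟨_, toRegimeFun_glue_mem_cuspCotSat hHD hI h₁ h₃ hA hV c hc⟩ =
      ofLevel hHD hI (ballQuotientUniformisedDatum_of h₁) h₃ hA Γ hΓ c := by
  rw [clsAt_apply, towerFamily_glue hHD hI h₁ h₃ hA hV c hc]

/-- **`clsHol ⟨glue c, _⟩ = ofLevel Γ c`**: on `(1,0)`-families of level `Γ`, the inverse gluing followed by A-p13's class map is the canonical map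
`H_K → H`. [cite: BorelWallach2000, VII 3.2; XIII 1.2] -/
theorem clsHol_glue (c : ↥(towerLevel hHD hI (ballQuotientUniformisedDatum_of h₁) h₃ hA Γ hΓ))
    (hc : c ∈ H10L hHD hI (ballQuotientUniformisedDatum_of h₁) h₃ hA Γ hΓ) :
    clsHol hHD hI h₁ h₃ hA hV ⟨_, glue_mem_holCotForms hHD hI h₁ h₃ hA hV c hc⟩ =
      ofLevel hHD hI (ballQuotientUniformisedDatum_of h₁) h₃ hA Γ hΓ c := by
  rw [clsHol_eq_clsAt hHD hI h₁ h₃ hA hV _ hΓ (toRegimeFun_glue_mem_cuspCotSat hHD hI h₁ h₃ hA hV c hc)]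
  exact clsAt_glue hHD hI h₁ h₃ hA hV c hc

/-! ## §2 `glue` is a left inverse: `glue (towerFamily F) = F ∘ e` -/

/-- **`glue (towerFamily F) = F ∘ e`** for a saturated cuspidal cotangent form `F` of level `Γ.K` on the regime model: at `x = ιinf u · k · (1,h)`
(honesty (6) of the factor of record) both sides are `F (archInfOf u · e_h)` (`pull (compClass F h) = comp F h`; `e k ∈ sat(Γ.K)`).
[cite: BorelWallach2000, XIII 1.2] [cite: BorelJacquet1979, §4.1] -/
theorem glue_towerFamily {F₀ : (V.latticeModel printFact_unitaryCompact_holds).G → (Fin 2 → ℂ)} (hF : F₀ ∈ cuspCotSat V hV Γ.K) :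
    glue hHD hI h₁ h₃ hV hΓ (towerFamily hHD hI h₁ h₃ hΓ hF) = LinearMap.funLeft ℂ (Fin 2 → ℂ) (latticeEquiv F V hV) F₀ := by
  obtain ⟨_, _, _, _, hcommKF, hdec, _⟩ := P4StubT1ArchFactor.archFactorOf_isHonest F V
  funext x
  obtain ⟨u, k, h, hk, rfl⟩ := hdec x
  rw [glue_eq_of_coords hHD hI h₁ h₃ hV hΓ _ _ (h := h) (u := u)
      (by rw [map_mul, map_mul, finCoord_ιinf, finCoord_eq_one_of_mem_Kc hk, finCoord_finToAdelic, one_mul, one_mul])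
      (by rw [map_mul, map_mul, archCoord_ιinf, archCoord_eq_one_of_mem_Kc hk, archCoord_finToAdelic, mul_one, mul_one]),
    towerFamily_apply, levelPull_eq_pinD_pull, pull_compClass, comp_apply, funLeft_latticeEquiv_apply, mul_assoc, hcommKF k hk h, ← mul_assoc,
    map_mul, map_mul, latticeEquiv_ιinf, latticeEquiv_finToAdelic]
  exact (cuspCotSat.apply_mul_of_mem_sat hF (latticeEquiv_mem_satLevelRegimeOf_of_mem_Kc F V hV Γ.K hk) _).symm

/-! ## §3 The `(1,0)`-part of the tower is the range of the holomorphic class map -/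

/-- **`H^{1,0}(tower) ⊆ range clsHol`**: every `(1,0)`-family of every level is the class of the glued holomorphic cotangent form.
[cite: BorelWallach2000, VII 3.2] [cite: VoisinHodgeI2002, §7.1.1 Cor. 7.6] -/
theorem H10T_le_range_clsHol :
    H10T hHD hI (ballQuotientUniformisedDatum_of h₁) h₃ hA V ≤ LinearMap.range (clsHol hHD hI h₁ h₃ hA hV) := by
  intro x hx
  obtain ⟨j, c, hc, rfl⟩ := (mem_H10T_iff hHD hI (ballQuotientUniformisedDatum_of h₁) h₃ hA V x).1 hx
  exact ⟨⟨_, glue_mem_holCotForms hHD hI h₁ h₃ hA hV c hc⟩, clsHol_glue hHD hI h₁ h₃ hA hV c hc⟩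

/-- **THE HOLOMORPHIC MATSUSHIMA ISOMORPHISM, range form: `range clsHol = H^{1,0}(tower)`** (with ★ `clsHol_injective`: `holCotForms 𝔞₀ ≅ H10T`).
[cite: BorelWallach2000, VII 3.2] [cite: VoisinHodgeI2002, §7.1.1 Cor. 7.6] -/
theorem range_clsHol_eq_H10T :
    LinearMap.range (clsHol hHD hI h₁ h₃ hA hV) = H10T hHD hI (ballQuotientUniformisedDatum_of h₁) h₃ hA V := by
  refine le_antisymm ?_ (H10T_le_range_clsHol hHD hI h₁ h₃ hA hV)
  rintro _ ⟨f, rfl⟩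
  exact clsHol_mem_hodge10Part F V hV hHD hI h₁ h₃ hA f

/-- **`clsHol` as a linear EQUIVALENCE `holCotForms 𝔞₀ ≃ₗ[ℂ] H^{1,0}(tower)`** (injective ★ `clsHol_injective` + `range_clsHol_eq_H10T`).
[cite: BorelWallach2000, VII 3.2] -/
def clsHolEquiv : ↥(holCotForms (archFactorOf F V)) ≃ₗ[ℂ] ↥(H10T hHD hI (ballQuotientUniformisedDatum_of h₁) h₃ hA V) :=
  (LinearEquiv.ofInjective (clsHol hHD hI h₁ h₃ hA hV) (clsHol_injective hHD hI h₁ h₃ hA hV)).trans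
    (LinearEquiv.ofEq _ _ (range_clsHol_eq_H10T hHD hI h₁ h₃ hA hV))

/-- `clsHolEquiv f = clsHol f` on underlying tower elements. [cite: BorelWallach2000, VII 3.2] -/
@[simp] theorem coe_clsHolEquiv (f : ↥(holCotForms (archFactorOf F V))) :
    (clsHolEquiv hHD hI h₁ h₃ hA hV f : Tower hHD hI (ballQuotientUniformisedDatum_of h₁) h₃ hA V) = clsHol hHD hI h₁ h₃ hA hV f := rfl

end Summit.HodgeConjecture.HodgeConjecture.Cruxes.H413.CuspCot

end
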